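/-
# `Balaban1983to89.B5Commutator128` — the Schur schema behind the paired commutator bound (1.128) of B5

CITATION HEADER (lean-in-tree rule).  Cell `pub-balaban`, unit `b2b-balaban-b05-g5` (PAPER SUB-CELL B05, gen 5, third
row; journal claim SHARPEN T02.2(l) COMMUTATOR-128-SCHUR).  B5 = T. Bałaban, *Propagators and renormalization
transformations for lattice gauge theories. I*, Commun. Math. Phys. **95**, 17–40 (1984) [`Balaban1984PropagatorsI`].
Sibling of `…B5TorusCover` (p180294) and `…B5TorusPartition` (p180458 / v1.1 p180514); consumer-side context:
`…B5Local114` (the leaf `Realisation.h128` / `Model.h128`, commutator `Kop Δa H z = H z * Δa − Δa * H z`).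

WHAT IS PRINTED (p. 38 [PDF 22], render `1984-cmp95-propagators-rt-I-p022-x2.png`, read as an image by this seat),
verbatim segments (omissions BETWEEN the segments, never inside «…»): «Next we have to estimate |h_{z₁}K(h_{z₂})A|. The
operator K(h) is a simple, shortranged, first order differential operator, except the term P₁(∂h_z). Let us write
bounds for the operator ∂P∂*.» — there follow the representation of `P`, Lemma 2.4 of [2], (1.45) and the analyticity
method — «We obtain |(∂P∂*)_{μ,ν}(x, x′)| ≤ O(1)e^{−δ′₀|x−x′|}, (1.126)» — then the Hölder bound (1.127) and the remark
that the constant in (1.126) depends on `d` only — «This implies a bound on the operator h_{z₁}K(h_{z₂}). We have to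
consider separately the cases when □_{z₁}, □_{z₂} are disjoint, and when they are overlapping. In the first case we
have only the operator h_{z₁}P₁(∂h_{z₂}) and (1.126) gives a bound with a small factor O(M₀⁻¹) and the exponential
factor exp(−⅓δ′₀|z₁ − z₂|) = exp(−⅓δ′₀M₀|z′₁ − z′₂|), where z′₁, z′₂ are points z₁, z₂ rescaled to the unit scale»
— the target lattice is named — «In the second case we have the small factor O(M₀⁻¹) only, but we may include the
factor exp(−|z′₁ − z′₂|) because |z′₁ − z′₂| ≤ 2d. Defining 2δ₀ = min{⅓δ′₀, M₀⁻¹}, we obtain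
|h_{z₁}K(h_{z₂})A| ≤ O(M₀⁻¹)e^{−2δ₀|z₁−z₂|}(|∇A| + |A|). (1.128)».
The printed formula for `K(h)` is (1.121) p. 37 (quoted in the docstring of `B5Local114.Kop`):
`K(h)A = Σ_b (∂h)(b)(∂A)(b) − (Δh)A + S*(∂h)QA − Q*S(∂h)A + P₁(∂h)A`.

WHAT THIS MODULE KERNEL-CHECKS (an operator-theoretic SCHEMA, Mathlib-elementary; NOT Bałaban's operators).
On `V = EuclideanSpace ℝ ι` (`ι` a finite index set of field components, placed over a pseudo-metric space `X` by a
base map `π : ι → X`):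
§1 kernel operators `kerOp k` (`(kerOp k v) i = Σ_j k i j · v j`), the identities `mulOp a * kerOp k = kerOp (a_i k_ij)`
and THE COMMUTATOR IDENTITY `mulOp a * kerOp k − kerOp k * mulOp a = kerOp ((a_i − a_j) k_ij)` — in particular
`Kop (kerOp k) (mulOp ∘ a) z = kerOp ((a z i − a z j) k_ij)`;
§2 the ℓ²-bound from the tree's finite Schur test `SchurTest.sum_sq_le` (`‖kerOp k v‖ ≤ R‖v‖` if all absolute row and
column sums are `≤ R`) and its decay form (`|k_ij| ≤ B e^{−β dist(π i, π j)}`, row sums `Σ_j e^{−β dist} ≤ Λ` ⇒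
`‖kerOp k v‖ ≤ BΛ‖v‖`);
§3 THE EXPONENTIAL BOOKKEEPING (`t e^{−ct} ≤ 1/(ec)` is the tree's `B11B3.mul_exp_neg_le`; the splits
`mul_exp_split`, `mul_exp_half`) and THE RATE CONVERSION «Defining 2δ₀ = min{⅓δ′₀, M₀⁻¹}»: for `s ≤ 2M₀`, `M₀ > 0`,
`e^{−(5δ/6)(T − 2s)⁺} ≤ e^7 · e^{−twoDelta0 δ M₀ · T}` (`exp_sep_le`, `B5Walk131.twoDelta0 δ M₀ = min (δ/3) M₀⁻¹`), and
for the local part `1 ≤ e^{4+ρ/M₀}·e^{−twoDelta0 δ M₀ · T}` whenever `T ≤ 2s + ρ` (`one_le_exp_local`);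
§4 THE KERNEL PART OF (1.128) («we have only the operator h_{z₁}P₁(∂h_{z₂}) and (1.126) gives a bound with a small
factor O(M₀⁻¹) and the exponential factor»): for a multiplier `a₂` that is `ℓ`-LIPSCHITZ along `π` and supported in
the `s`-ball of a centre `c₂`, a bounded multiplier `a₁` (`|a₁| ≤ 1`) supported in the `s`-ball of `c₁`, and a kernel
with `|k_ij| ≤ C e^{−δ dist(π i, π j)}`: every entry of `mulOp a₁ * [mulOp a₂, kerOp k]` is
`≤ ℓ·C·(24/(eδ))·e^{−(5δ/6)(dist(c₁,c₂) − 2s)⁺}·e^{−(δ/8)dist(π i, π j)}` (`entry_three_le`: the small factor `ℓ`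
from `|a₂ i − a₂ j| ≤ ℓ·dist` against `dist·e^{−δ dist}`, the exponential factor from the separation of the supports),
hence `‖mulOp a₁ ([mulOp a₂, kerOp k] v)‖ ≤ ℓ·C·(24/(eδ))·Λ·e^{−(5δ/6)(dist(c₁,c₂) − 2s)⁺}·‖v‖` with `Λ` the row-sum
bound at rate `δ/8` (`norm_three_kernel_le`); the unpaired form of «the small factor O(M₀⁻¹) only» `‖[mulOp a, kerOp k] v‖ ≤
ℓ·C·(2/(eδ))·Λ′·‖v‖` (`norm_comm_kernel_le`, `Λ′` at rate `δ/2`);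
§5 THE LOCAL PART: for a finite-range kernel `l` (`l_ij = 0` if `dist(π i, π j) > ρ`) the paired commutator VANISHES
beyond the reach of the supports, `mulOp a₁ * [mulOp a₂, kerOp l] = 0` if `dist(c₁,c₂) > 2s + ρ` (`three_local_eq_zero`);
its SIZE is NOT estimated here — it enters §6 as the normed hypothesis `‖[mulOp (a z), kerOp l] A‖ ≤ ℓ₁(‖Dg A‖ + ‖A‖)`
(field `local_norm` of `Schema`), whose discharge for Bałaban's `Δ_a` is the computation (1.121) and needs `∂h = O(M₀⁻¹)`
AND `Δh = O(M₀⁻²)` uniformly in the lattice spacing (cell GAPS G-B5-28a: the Lipschitz profiles of `B5TorusPartition`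
give the first, not the second);
§6 ASSEMBLY (`h128_schema`): for `Δa = kerOp l + kerOp k` and `H z = mulOp (a z)` under the hypotheses collected in
`Schema` (profiles `|a z| ≤ 1`, supports in `s`-balls around `c z`, `ℓ`-Lipschitz; `l` of range `ρ` with the local
normed hypothesis `ℓ₁`; `|k_ij| ≤ C e^{−δ dist}`; row sums `Λ` at rate `δ/8`) and `0 < M₀`, `s ≤ 2M₀`:
`‖H z₁ (Kop Δa H z₂ A)‖ ≤ (ℓ₁·e^{4+ρ/M₀} + ℓ·C·(24/(eδ))·Λ·e^7) · e^{−twoDelta0 δ M₀ · dist(c z₁, c z₂)} · (‖Dg A‖ + ‖A‖)`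
— the SHAPE of the field `h128` of `B5Local114.Model` / `.Realisation` (`θ·e^{−2δ₀ dist(ctr z₁, ctr z₂)}·(‖Dg A‖ + ‖A‖)`,
`2δ₀ = twoDelta0 δ′₀ M₀`); and its specialisation `h128_torus` to the partition of unity of `B5TorusPartition`
(`H = Hop N M₀ π`, `c = ctrU N M₀`, `s = 2M₀`, `ℓ = 8d/M₀` by `hzU_lipschitz`), where the constant reads
`ℓ₁·e^{4+ρ/M₀} + (8d/M₀)·C·(24/(eδ))·Λ·e^7` — of the printed order `O(M₀⁻¹)` as soon as `ℓ₁ = O(M₀⁻¹)`.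

§7 ROW SUMS IN THE TORUS MODEL (`rowsum_fibre_le`): for a base map `π : ι → UT N` with fibres of size `≤ m`,
`Σ_j e^{−β dist(π i, π j)} ≤ m·K_d(β)` uniformly in the periods (the tree's `B4Sect5Torus.torusSum_le`,
`B4Sect5Proof.latticeConst`) — discharging `Schema.rowsum`; `h128_torus_fibre` = `h128_torus` with `Λ := m·K_d(δ/8)`,
whose ONLY remaining hypotheses are the split/local bound ((1.121)) and the decay ((1.126)).

THE FINE-TORUS DICTIONARY (for instantiators; informational).  In B5 the functions `h_z` and the operators live on
the `η`-lattice `T_η` (`η = L^{−k}`), and the unit cubes of side `M₀` contain `M₀/η` fine steps.  `B5TorusPartition` /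
this module are stated for ANY torus `Π_i ℤ/N_iℤ` and ANY `M₀ : ℕ`, so the faithful instantiation takes the FINE
periods and `M₀ ↦ M₀/η = M₀L^k ∈ ℕ` (fine units), `δ ↦ δ′₀η` (decay per fine step), `ℓ = 8d/(M₀/η) = 8dη/M₀`,
kernel entries `C ↦ η^d·O(1)` (matrix of `∂P∂*` in the `η^d`-weighted `ℓ²`), `Λ = m·K_d(δ′₀η/8) = O(η^{−d})`,
range of the local part `ρ ↦ ρ_unit/η` fine steps (so `ρ/M₀ = ρ_unit/M₀` and `e^{4+ρ/M₀}` is scale-free): then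
`twoDelta0 (δ′₀η) (M₀/η)·dist_fine = min{⅓δ′₀, M₀⁻¹}·dist_unit` (the printed rate exactly) and the kernel constant
`ℓ·C·(24/(eδ))·Λ·e^7 = O(M₀⁻¹)` uniformly in `η`; the local constant `ℓ₁` must ALSO be `O(M₀⁻¹)` uniformly in `η`,
which is where the second differences of the profiles enter (cell GAPS G-B5-28a: Lipschitz profiles give
`Δ^η h = O(M₀⁻¹η⁻¹)` only; C^{1,1} profiles are needed).

HONEST LABELLING.  Nothing here is a statement of B5: the module proves an abstract ℓ²-schema (Schur test +
Lipschitz multipliers + support geometry) whose hypotheses an instantiation must supply — the decomposition of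
Bałaban's `Δ_a = Δ − ∂P∂* + aQ*Q` ((1.69)) into a finite-range part `kerOp l` (the «simple, shortranged, first order
differential operator» part of K(h) comes from it) and the kernel part `kerOp k = −∂P∂*` with (1.126) for `k`
(a NAMED leaf elsewhere in the tree, `B5.Kernel126_127Printed`), the local normed bound `ℓ₁ = O(M₀⁻¹)` ((1.121) with
`∂h`, `Δh` — G-B5-28a), and the uniform row sums `Λ` (in the η-lattice model the matrix entries are `η^d`·kernel, so
`C·Λ` is the uniform quantity).  The only quotations are the p. 38 sentences above and (1.121) as already quoted in
the tree.  DIVERGENCE D-b05g5.3: (i) the exponential bookkeeping loses `δ′₀ → 5δ′₀/6 → δ′₀/3` with absolute factors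
`24/e`, `e^7`, `e^{4+ρ/M₀}` where print writes O(1); (ii) supports of radius `s ≤ 2M₀` (the `B5TorusPartition` cubes of
side 4M₀) instead of the printed □_z — immaterial for the rate `2δ₀ = min{⅓δ′₀, M₀⁻¹}`, which is reproduced exactly;
(iii) distances in any pseudo-metric space `X` (sup or Euclidean torus distance alike).
v1.1 (same seat): docstring-only — three guillemet sites made verbatim (a bracketed gloss and two ellipses had
been placed inside «…» in v1 = p180910); no declaration changed. v1.2 (same seat): §7 added (`rowsum_fibre_le`,
`h128_torus_fibre`) with the fine-torus dictionary paragraph, and ONE SHARPENING forced by that dictionary: the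
local-part factor `e^{4+ρ}` of v1/v1.1 (`one_le_exp_local`, `h128_schema`, `h128_torus`) is now the scale-free
`e^{4+ρ/M₀}` (v1.1 had loosened `ρ/M₀ ≤ ρ` using `M₀ ≥ 1`, which is not uniform when `ρ` and `M₀` are both counted in
fine steps); accordingly `Schema.range_nonneg` is dropped and `h128_schema` asks only `0 < M₀`.  No consumer existed.  Also:
DOCFIX of XREAD objection G-ref6-3 (ref6-g12: header «small factor only» was not a contiguous printed phrase → now
«the small factor O(M₀⁻¹) only»), and the header quotation of p. 38 is split into verbatim segments (v1.1 still had
omission marks inside one «…»).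
value = kernel certificate of the analytic schema of a located leaf (h128), NOT summit progress.
-/
import Mathlib
import Literature.MathematicalPhysics.QuantumFieldTheory.Balaban1983to89.SchurTest
import Literature.MathematicalPhysics.QuantumFieldTheory.Balaban1983to89.B11B3
import Literature.MathematicalPhysics.QuantumFieldTheory.Balaban1983to89.B5Local114
import Literature.MathematicalPhysics.QuantumFieldTheory.Balaban1983to89.B5TorusPartition

open Finset

namespace Literature.MathematicalPhysics.QuantumFieldTheory.Balaban1983to89.B5Commutator128

open B5TorusPartition (mulOp mulOp_apply mulOp_eq_zero_of_vanish norm_mulOp_le hzU Hop hzU_lipschitz hzU_mem_Icc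
  hz_eq_zero_of_le)
open B5Local114 (Kop)
open B5Walk131 (twoDelta0 twoDelta0_le_inv)
open B5TorusCover (UT Ctr ctrU)
open B4Sect5Torus (tdist torusSum_le)
open B11B3 (mul_exp_neg_le)

noncomputable section

/-! ## §1  Kernel operators on `ℓ²(ι)` and the commutator identity -/

section Kernel

variable {ι : Type} [Fintype ι]

/-- The operator with matrix / kernel `k` on `ℓ²(ι) = EuclideanSpace ℝ ι`: `(kerOp k v) i = Σ_j k i j · v j`.
[folklore] -/
def kerOp (k : ι → ι → ℝ) : Module.End ℝ (EuclideanSpace ℝ ι) where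
  toFun v := WithLp.toLp 2 fun i => ∑ j, k i j * v j
  map_add' u v := by
    ext i
    simp only [PiLp.add_apply, mul_add, Finset.sum_add_distrib]
  map_smul' c v := by
    ext i
    simp only [PiLp.smul_apply, smul_eq_mul, RingHom.id_apply, Finset.mul_sum]
    exact Finset.sum_congr rfl fun j _ => by ring

/-- `(kerOp k v) i = Σ_j k i j · v j`. [folklore] -/
@[simp] theorem kerOp_apply (k : ι → ι → ℝ) (v : EuclideanSpace ℝ ι) (i : ι) :
    kerOp k v i = ∑ j, k i j * v j := rfl

/-- Left multiplication by a multiplier rescales the rows: `mulOp a * kerOp k = kerOp (a_i k_ij)`. [folklore] -/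
theorem mulOp_mul_kerOp (a : ι → ℝ) (k : ι → ι → ℝ) :
    mulOp a * kerOp k = kerOp fun i j => a i * k i j := by
  apply LinearMap.ext
  intro v
  ext i
  simp only [Module.End.mul_apply, mulOp_apply, kerOp_apply, Finset.mul_sum, mul_assoc]

/-- Right multiplication by a multiplier rescales the columns: `kerOp k * mulOp a = kerOp (k_ij a_j)`. [folklore] -/
theorem kerOp_mul_mulOp (a : ι → ℝ) (k : ι → ι → ℝ) :
    kerOp k * mulOp a = kerOp fun i j => k i j * a j := by
  apply LinearMap.ext
  intro v
  ext i
  simp only [Module.End.mul_apply, mulOp_apply, kerOp_apply, mul_assoc]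

/-- `kerOp` is additive in the kernel. [folklore] -/
theorem kerOp_add (k k' : ι → ι → ℝ) : kerOp (fun i j => k i j + k' i j) = kerOp k + kerOp k' := by
  apply LinearMap.ext
  intro v
  ext i
  simp only [kerOp_apply, LinearMap.add_apply, PiLp.add_apply, add_mul, Finset.sum_add_distrib]

/-- `kerOp` is subtractive in the kernel. [folklore] -/
theorem kerOp_sub (k k' : ι → ι → ℝ) : kerOp (fun i j => k i j - k' i j) = kerOp k - kerOp k' := by
  apply LinearMap.ext
  intro v
  ext i
  simp only [kerOp_apply, LinearMap.sub_apply, PiLp.sub_apply, sub_mul, Finset.sum_sub_distrib]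

/-- The zero kernel gives the zero operator. [folklore] -/
theorem kerOp_eq_zero_of_forall {k : ι → ι → ℝ} (h : ∀ i j, k i j = 0) : kerOp k = 0 := by
  apply LinearMap.ext
  intro v
  ext i
  simp only [kerOp_apply, h, zero_mul, Finset.sum_const_zero, LinearMap.zero_apply, PiLp.zero_apply]

/-- **The commutator identity**: `mulOp a * kerOp k − kerOp k * mulOp a = kerOp ((a_i − a_j) k_ij)` — the commutator of
a multiplier with a kernel operator is the kernel operator weighted by the DIFFERENCES of the multiplier (the lattice
form of a «first order differential operator»: only `a_i − a_j` enters). [folklore] -/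
theorem comm_mulOp_kerOp (a : ι → ℝ) (k : ι → ι → ℝ) :
    mulOp a * kerOp k - kerOp k * mulOp a = kerOp fun i j => (a i - a j) * k i j := by
  rw [mulOp_mul_kerOp, kerOp_mul_mulOp, ← kerOp_sub]
  congr 1
  funext i j
  ring

/-- The commutator `Kop` of `B5Local114` for a kernel operator and a family of multipliers:
`Kop (kerOp k) (mulOp ∘ a) z = kerOp ((a z i − a z j) k_ij)`. [cite: Balaban1984PropagatorsI, (1.121) p.37 (the
operator identity K(h) = hΔ_a − Δ_a h only)] -/
theorem Kop_kerOp_mulOp {S : Type} (k : ι → ι → ℝ) (a : S → ι → ℝ) (z : S) :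
    Kop (kerOp k) (fun z => mulOp (a z)) z = kerOp fun i j => (a z i - a z j) * k i j := by
  unfold Kop
  exact comm_mulOp_kerOp (a z) k

/-- `Kop` is additive in the operator: `K_{L+K}(h) = K_L(h) + K_K(h)`. [folklore] -/
theorem Kop_add {V : Type} [AddCommGroup V] [Module ℝ V] {S : Type} (L K : Module.End ℝ V)
    (H : S → Module.End ℝ V) (z : S) : Kop (L + K) H z = Kop L H z + Kop K H z := by
  simp only [Kop, mul_add, add_mul]
  abel

/-- The paired commutator with a kernel operator is again a kernel operator:
`mulOp a₁ * (mulOp a₂ * kerOp k − kerOp k * mulOp a₂) = kerOp (a₁ i (a₂ i − a₂ j) k_ij)`. [folklore] -/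
theorem three_eq_kerOp (a₁ a₂ : ι → ℝ) (k : ι → ι → ℝ) :
    mulOp a₁ * (mulOp a₂ * kerOp k - kerOp k * mulOp a₂)
      = kerOp fun i j => a₁ i * ((a₂ i - a₂ j) * k i j) := by
  rw [comm_mulOp_kerOp, mulOp_mul_kerOp]

end Kernel

/-! ## §2  The ℓ²-bound of a kernel operator (finite Schur test) -/

section Schur

variable {ι : Type} [Fintype ι]

/-- **Schur bound**: if every absolute row sum and every absolute column sum of `k` is `≤ R`, then
`‖kerOp k v‖ ≤ R‖v‖` (from the tree's `SchurTest.sum_sq_le`). [folklore] (Schur test) -/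
theorem norm_kerOp_le {k : ι → ι → ℝ} {R : ℝ} (hR : ∀ i, ∑ j, |k i j| ≤ R) (hC : ∀ j, ∑ i, |k i j| ≤ R)
    (v : EuclideanSpace ℝ ι) : ‖kerOp k v‖ ≤ R * ‖v‖ := by
  rcases isEmpty_or_nonempty ι with hι | ⟨⟨i₀⟩⟩
  · have h1 : ‖kerOp k v‖ = 0 := by rw [EuclideanSpace.norm_eq]; simp
    have h2 : ‖v‖ = 0 := by rw [EuclideanSpace.norm_eq]; simp
    rw [h1, h2, mul_zero]
  have hR0 : 0 ≤ R := le_trans (Finset.sum_nonneg fun j _ => abs_nonneg _) (hR i₀)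
  have key := SchurTest.sum_sq_le k (fun j => v j) hR hC
  rw [EuclideanSpace.norm_eq, EuclideanSpace.norm_eq]
  have e1 : ∑ i, ‖kerOp k v i‖ ^ 2 = ∑ i, (∑ j, k i j * v j) ^ 2 :=
    Finset.sum_congr rfl fun i _ => by rw [kerOp_apply, Real.norm_eq_abs, sq_abs]
  have e2 : ∑ i, ‖v i‖ ^ 2 = ∑ j, v j ^ 2 :=
    Finset.sum_congr rfl fun i _ => by rw [Real.norm_eq_abs, sq_abs]
  rw [e1, e2]
  calc Real.sqrt (∑ i, (∑ j, k i j * v j) ^ 2) ≤ Real.sqrt (R * R * ∑ j, v j ^ 2) := Real.sqrt_le_sqrt key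
    _ = R * Real.sqrt (∑ j, v j ^ 2) := by
        rw [Real.sqrt_mul (mul_nonneg hR0 hR0), Real.sqrt_mul_self hR0]

variable {X : Type} [PseudoMetricSpace X]

/-- **Schur bound, decay form**: `|k_ij| ≤ B e^{−β dist(π i, π j)}` and uniform row sums `Σ_j e^{−β dist(π i, π j)} ≤ Λ`
give `‖kerOp k v‖ ≤ BΛ‖v‖` (column sums = row sums by the symmetry of `dist`). [folklore] (Schur test) -/
theorem norm_kerOp_le_of_decay (π : ι → X) {k : ι → ι → ℝ} {B β Λ : ℝ} (hB : 0 ≤ B)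
    (hk : ∀ i j, |k i j| ≤ B * Real.exp (-(β * dist (π i) (π j))))
    (hΛ : ∀ i, ∑ j, Real.exp (-(β * dist (π i) (π j))) ≤ Λ) (v : EuclideanSpace ℝ ι) :
    ‖kerOp k v‖ ≤ B * Λ * ‖v‖ := by
  have hrow : ∀ i, ∑ j, |k i j| ≤ B * Λ := by
    intro i
    calc ∑ j, |k i j| ≤ ∑ j, B * Real.exp (-(β * dist (π i) (π j))) := Finset.sum_le_sum fun j _ => hk i j
      _ = B * ∑ j, Real.exp (-(β * dist (π i) (π j))) := by rw [Finset.mul_sum]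
      _ ≤ B * Λ := mul_le_mul_of_nonneg_left (hΛ i) hB
  have hcol : ∀ j, ∑ i, |k i j| ≤ B * Λ := by
    intro j
    calc ∑ i, |k i j| ≤ ∑ i, B * Real.exp (-(β * dist (π i) (π j))) := Finset.sum_le_sum fun i _ => hk i j
      _ = B * ∑ i, Real.exp (-(β * dist (π j) (π i))) := by
          rw [Finset.mul_sum]
          exact Finset.sum_congr rfl fun i _ => by rw [dist_comm]
      _ ≤ B * Λ := mul_le_mul_of_nonneg_left (hΛ j) hB
  exact norm_kerOp_le hrow hcol v

end Schur

/-! ## §3  Elementary exponential arithmetic (`t e^{−ct} ≤ 1/(ec)` is the tree's `B11B3.mul_exp_neg_le`) -/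

section ExpArith

/-- Splitting the decay: for `t ≥ D ≥ 0`,
`t e^{−δt} ≤ (24/(eδ)) · e^{−(5δ/6)D} · e^{−(δ/8)t}` (`1/24 + 5/6 + 1/8 = 1`). [folklore] -/
theorem mul_exp_split {δ t D : ℝ} (hδ : 0 < δ) (hD : D ≤ t) :
    t * Real.exp (-(δ * t))
      ≤ 24 / (Real.exp 1 * δ) * Real.exp (-(5 * δ / 6 * D)) * Real.exp (-(δ / 8 * t)) := by
  have h1 : t * Real.exp (-(δ / 24 * t)) ≤ 24 / (Real.exp 1 * δ) := by
    have := mul_exp_neg_le (s := δ / 24) (by positivity) t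
    calc t * Real.exp (-(δ / 24 * t)) ≤ 1 / (Real.exp 1 * (δ / 24)) := this
      _ = 24 / (Real.exp 1 * δ) := by field_simp
  have h2 : Real.exp (-(5 * δ / 6 * t)) ≤ Real.exp (-(5 * δ / 6 * D)) := by
    apply Real.exp_le_exp.mpr
    have : 5 * δ / 6 * D ≤ 5 * δ / 6 * t := mul_le_mul_of_nonneg_left hD (by positivity)
    linarith
  have hsplit : Real.exp (-(δ * t))
      = Real.exp (-(δ / 24 * t)) * Real.exp (-(5 * δ / 6 * t)) * Real.exp (-(δ / 8 * t)) := by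
    rw [← Real.exp_add, ← Real.exp_add]
    congr 1
    ring
  rw [hsplit]
  have e3 : 0 ≤ Real.exp (-(δ / 8 * t)) := (Real.exp_pos _).le
  have e2 : 0 ≤ Real.exp (-(5 * δ / 6 * t)) := (Real.exp_pos _).le
  have hab : t * Real.exp (-(δ / 24 * t)) * Real.exp (-(5 * δ / 6 * t))
      ≤ 24 / (Real.exp 1 * δ) * Real.exp (-(5 * δ / 6 * D)) := by
    rcases le_or_gt 0 (t * Real.exp (-(δ / 24 * t))) with h | h
    · calc t * Real.exp (-(δ / 24 * t)) * Real.exp (-(5 * δ / 6 * t))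
          ≤ 24 / (Real.exp 1 * δ) * Real.exp (-(5 * δ / 6 * t)) := mul_le_mul_of_nonneg_right h1 e2
        _ ≤ 24 / (Real.exp 1 * δ) * Real.exp (-(5 * δ / 6 * D)) :=
          mul_le_mul_of_nonneg_left h2 (by positivity)
    · calc t * Real.exp (-(δ / 24 * t)) * Real.exp (-(5 * δ / 6 * t)) ≤ 0 :=
          mul_nonpos_of_nonpos_of_nonneg h.le e2
        _ ≤ 24 / (Real.exp 1 * δ) * Real.exp (-(5 * δ / 6 * D)) := by positivity
  calc t * (Real.exp (-(δ / 24 * t)) * Real.exp (-(5 * δ / 6 * t)) * Real.exp (-(δ / 8 * t)))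
      = t * Real.exp (-(δ / 24 * t)) * Real.exp (-(5 * δ / 6 * t)) * Real.exp (-(δ / 8 * t)) := by ring
    _ ≤ 24 / (Real.exp 1 * δ) * Real.exp (-(5 * δ / 6 * D)) * Real.exp (-(δ / 8 * t)) :=
        mul_le_mul_of_nonneg_right hab e3

/-- The unpaired split: `t e^{−δt} ≤ (2/(eδ)) e^{−(δ/2)t}`. [folklore] -/
theorem mul_exp_half {δ : ℝ} (hδ : 0 < δ) (t : ℝ) :
    t * Real.exp (-(δ * t)) ≤ 2 / (Real.exp 1 * δ) * Real.exp (-(δ / 2 * t)) := by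
  have h1 : t * Real.exp (-(δ / 2 * t)) ≤ 2 / (Real.exp 1 * δ) := by
    have := mul_exp_neg_le (s := δ / 2) (by positivity) t
    calc t * Real.exp (-(δ / 2 * t)) ≤ 1 / (Real.exp 1 * (δ / 2)) := this
      _ = 2 / (Real.exp 1 * δ) := by field_simp
  have hsplit : Real.exp (-(δ * t)) = Real.exp (-(δ / 2 * t)) * Real.exp (-(δ / 2 * t)) := by
    rw [← Real.exp_add]
    congr 1
    ring
  rw [hsplit, ← mul_assoc]
  exact mul_le_mul_of_nonneg_right h1 (Real.exp_pos _).le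

/-- **The rate conversion** «Defining 2δ₀ = min{⅓δ′₀, M₀⁻¹}»: with supports of radius `s ≤ 2M₀`, the separation factor
`e^{−(5δ/6)(T − 2s)⁺}` is at most `e^7 · e^{−2δ₀T}`, `2δ₀ = twoDelta0 δ M₀ = min (δ/3) M₀⁻¹` (for `T ≥ 7M₀` the rate
`5δ/6` on `T − 4M₀` beats `δ/3` on `T`; for `T ≤ 7M₀` the right side is `≥ e^7e^{−7}`).
[cite: Balaban1984PropagatorsI, p.38 before (1.128)] -/
theorem exp_sep_le {δ M₀ T s : ℝ} (hδ : 0 < δ) (hM : 0 < M₀) (hs : s ≤ 2 * M₀) (hT : 0 ≤ T) :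
    Real.exp (-(5 * δ / 6 * max 0 (T - 2 * s))) ≤ Real.exp 7 * Real.exp (-(twoDelta0 δ M₀ * T)) := by
  rw [← Real.exp_add]
  apply Real.exp_le_exp.mpr
  have hκ3 : twoDelta0 δ M₀ ≤ δ / 3 := min_le_left _ _
  have hκM : twoDelta0 δ M₀ ≤ M₀⁻¹ := twoDelta0_le_inv δ M₀
  have hD0 : 0 ≤ max 0 (T - 2 * s) := le_max_left _ _
  have hD1 : T - 4 * M₀ ≤ max 0 (T - 2 * s) := le_trans (by linarith) (le_max_right _ _)
  rcases le_or_gt T (7 * M₀) with h7 | h7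
  · -- short range: `2δ₀ T ≤ T/M₀ ≤ 7`
    have hκT : twoDelta0 δ M₀ * T ≤ 7 := by
      calc twoDelta0 δ M₀ * T ≤ M₀⁻¹ * T := mul_le_mul_of_nonneg_right hκM hT
        _ ≤ M₀⁻¹ * (7 * M₀) := mul_le_mul_of_nonneg_left h7 (inv_nonneg.mpr hM.le)
        _ = 7 := by field_simp
    have : 0 ≤ 5 * δ / 6 * max 0 (T - 2 * s) := by positivity
    linarith
  · -- long range: `(5δ/6)(T − 4M₀) ≥ (δ/3)T` for `T ≥ 20M₀/3`
    have hκT : twoDelta0 δ M₀ * T ≤ δ / 3 * T := mul_le_mul_of_nonneg_right hκ3 hT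
    have hmain : δ / 3 * T ≤ 5 * δ / 6 * (T - 4 * M₀) := by nlinarith
    have : 5 * δ / 6 * (T - 4 * M₀) ≤ 5 * δ / 6 * max 0 (T - 2 * s) :=
      mul_le_mul_of_nonneg_left hD1 (by positivity)
    linarith

/-- **Local-part conversion**: if `T ≤ 2s + ρ` with `s ≤ 2M₀`, `M₀ > 0`, then `1 ≤ e^{4+ρ/M₀}·e^{−2δ₀T}`
(`2δ₀T ≤ T/M₀ ≤ 4 + ρ/M₀`; the ratio `ρ/M₀` — range of the local part over the cube size — is scale-free).
[cite: Balaban1984PropagatorsI, p.38 («In the second case we have the small factor O(M₀⁻¹) only, but we may include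
the factor exp(−|z′₁ − z′₂|) because |z′₁ − z′₂| ≤ 2d.»)] -/
theorem one_le_exp_local {δ M₀ T s ρ : ℝ} (hM : 0 < M₀) (hs : s ≤ 2 * M₀) (hT : 0 ≤ T)
    (hTle : T ≤ 2 * s + ρ) : 1 ≤ Real.exp (4 + ρ / M₀) * Real.exp (-(twoDelta0 δ M₀ * T)) := by
  rw [← Real.exp_add]
  apply Real.one_le_exp
  have hκM : twoDelta0 δ M₀ ≤ M₀⁻¹ := twoDelta0_le_inv δ M₀
  have h1 : twoDelta0 δ M₀ * T ≤ M₀⁻¹ * T := mul_le_mul_of_nonneg_right hκM hT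
  have h2 : M₀⁻¹ * T ≤ M₀⁻¹ * (4 * M₀ + ρ) :=
    mul_le_mul_of_nonneg_left (by linarith) (inv_nonneg.mpr hM.le)
  have h3 : M₀⁻¹ * (4 * M₀ + ρ) = 4 + ρ / M₀ := by field_simp
  linarith

end ExpArith

/-! ## §4  The kernel part of (1.128): Lipschitz multiplier against a decaying kernel -/

section KernelPart

variable {ι : Type} {X : Type} [PseudoMetricSpace X]

/-- Separation of supports: if `a₁` lives in the `s`-ball of `c₁` and `a₂` in the `s`-ball of `c₂`, two components
carrying `a₁ i ≠ 0`, `a₂ j ≠ 0` are at distance `≥ dist(c₁,c₂) − 2s`. [folklore] -/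
theorem sep_of_supp (π : ι → X) {a₁ a₂ : ι → ℝ} {c₁ c₂ : X} {s : ℝ}
    (h₁ : ∀ i, a₁ i ≠ 0 → dist (π i) c₁ ≤ s) (h₂ : ∀ j, a₂ j ≠ 0 → dist (π j) c₂ ≤ s)
    {i j : ι} (hi : a₁ i ≠ 0) (hj : a₂ j ≠ 0) : dist c₁ c₂ - 2 * s ≤ dist (π i) (π j) := by
  have e1 := h₁ i hi
  have e2 := h₂ j hj
  rw [dist_comm] at e1
  have : dist c₁ c₂ ≤ dist c₁ (π i) + dist (π i) (π j) + dist (π j) c₂ :=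
    le_trans (dist_triangle c₁ (π j) c₂) (by linarith [dist_triangle c₁ (π i) (π j)])
  linarith

/-- The entries of the paired commutator live at distance `≥ (dist(c₁,c₂) − 2s)⁺`: whenever
`a₁ i · (a₂ i − a₂ j) ≠ 0`. [folklore] -/
theorem sepPos_of_entry_ne (π : ι → X) {a₁ a₂ : ι → ℝ} {c₁ c₂ : X} {s : ℝ}
    (h₁ : ∀ i, a₁ i ≠ 0 → dist (π i) c₁ ≤ s) (h₂ : ∀ j, a₂ j ≠ 0 → dist (π j) c₂ ≤ s)
    {i j : ι} (hi : a₁ i ≠ 0) (hij : a₂ i - a₂ j ≠ 0) :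
    max 0 (dist c₁ c₂ - 2 * s) ≤ dist (π i) (π j) := by
  apply max_le dist_nonneg
  by_cases hj : a₂ j = 0
  · -- then `a₂ i ≠ 0`, both centres are within `s` of `π i`
    have hi2 : a₂ i ≠ 0 := by
      intro h0
      exact hij (by rw [h0, hj, sub_zero])
    have e1 := h₁ i hi
    have e2 := h₂ i hi2
    rw [dist_comm] at e1
    have : dist c₁ c₂ ≤ s + s := le_trans (dist_triangle c₁ (π i) c₂) (add_le_add e1 e2)
    linarith [dist_nonneg (x := π i) (y := π j)]
  · exact sep_of_supp π h₁ h₂ hi hj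

/-- **Entry bound for the paired commutator with a decaying kernel** (the small factor `ℓ` and the exponential factor
in the separation): with `|a₁| ≤ 1`, `a₂` `ℓ`-Lipschitz along `π` (`ℓ ≥ 0`), supports in `s`-balls around `c₁`, `c₂`,
and `|k_ij| ≤ C e^{−δ dist(π i, π j)}`,
`|a₁ i (a₂ i − a₂ j) k_ij| ≤ ℓ·C·(24/(eδ))·e^{−(5δ/6)(dist(c₁,c₂) − 2s)⁺}·e^{−(δ/8)dist(π i, π j)}`.
[cite: Balaban1984PropagatorsI, p.38 («(1.126) gives a bound with a small factor O(M₀⁻¹) and the exponential factor»)] -/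
theorem entry_three_le (π : ι → X) {a₁ a₂ : ι → ℝ} {c₁ c₂ : X} {s ℓ C δ : ℝ} {k : ι → ι → ℝ}
    (hδ : 0 < δ) (hC : 0 ≤ C) (hℓ : 0 ≤ ℓ)
    (hb : ∀ i, |a₁ i| ≤ 1) (h₁ : ∀ i, a₁ i ≠ 0 → dist (π i) c₁ ≤ s)
    (h₂ : ∀ j, a₂ j ≠ 0 → dist (π j) c₂ ≤ s) (hlip : ∀ i j, |a₂ i - a₂ j| ≤ ℓ * dist (π i) (π j))
    (hk : ∀ i j, |k i j| ≤ C * Real.exp (-(δ * dist (π i) (π j)))) (i j : ι) :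
    |a₁ i * ((a₂ i - a₂ j) * k i j)|
      ≤ ℓ * C * (24 / (Real.exp 1 * δ)) * Real.exp (-(5 * δ / 6 * max 0 (dist c₁ c₂ - 2 * s)))
        * Real.exp (-(δ / 8 * dist (π i) (π j))) := by
  by_cases h0 : a₁ i * (a₂ i - a₂ j) = 0
  · have : a₁ i * ((a₂ i - a₂ j) * k i j) = 0 := by rw [← mul_assoc, h0, zero_mul]
    rw [this, abs_zero]
    positivity
  have hi : a₁ i ≠ 0 := fun h => h0 (by rw [h, zero_mul])
  have hij : a₂ i - a₂ j ≠ 0 := fun h => h0 (by rw [h, mul_zero])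
  have hD := sepPos_of_entry_ne π h₁ h₂ hi hij
  have ht0 : 0 ≤ dist (π i) (π j) := dist_nonneg
  have step1 : |a₁ i * ((a₂ i - a₂ j) * k i j)|
      ≤ ℓ * C * (dist (π i) (π j) * Real.exp (-(δ * dist (π i) (π j)))) := by
    rw [abs_mul, abs_mul]
    calc |a₁ i| * (|a₂ i - a₂ j| * |k i j|)
        ≤ 1 * ((ℓ * dist (π i) (π j)) * (C * Real.exp (-(δ * dist (π i) (π j))))) := by
          apply mul_le_mul (hb i) _ (by positivity) zero_le_one
          exact mul_le_mul (hlip i j) (hk i j) (abs_nonneg _) (by positivity)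
      _ = ℓ * C * (dist (π i) (π j) * Real.exp (-(δ * dist (π i) (π j)))) := by ring
  have step2 := mul_exp_split hδ hD
  calc |a₁ i * ((a₂ i - a₂ j) * k i j)|
      ≤ ℓ * C * (dist (π i) (π j) * Real.exp (-(δ * dist (π i) (π j)))) := step1
    _ ≤ ℓ * C * (24 / (Real.exp 1 * δ) * Real.exp (-(5 * δ / 6 * max 0 (dist c₁ c₂ - 2 * s)))
          * Real.exp (-(δ / 8 * dist (π i) (π j)))) := mul_le_mul_of_nonneg_left step2 (by positivity)
    _ = _ := by ring

variable [Fintype ι]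

/-- **The kernel part of (1.128), operator form**: under the hypotheses of `entry_three_le` and uniform row sums
`Σ_j e^{−(δ/8)dist(π i, π j)} ≤ Λ`,
`‖mulOp a₁ ([mulOp a₂, kerOp k] v)‖ ≤ ℓ·C·(24/(eδ))·Λ·e^{−(5δ/6)(dist(c₁,c₂) − 2s)⁺}·‖v‖`
— «a bound with a small factor O(M₀⁻¹) and the exponential factor» (the small factor here is `ℓ`, which is
`O(M₀⁻¹)` for the partition of unity of `B5TorusPartition`).
[cite: Balaban1984PropagatorsI, p.38 before (1.128)] -/
theorem norm_three_kernel_le (π : ι → X) {a₁ a₂ : ι → ℝ} {c₁ c₂ : X} {s ℓ C δ Λ : ℝ} {k : ι → ι → ℝ}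
    (hδ : 0 < δ) (hC : 0 ≤ C) (hℓ : 0 ≤ ℓ)
    (hb : ∀ i, |a₁ i| ≤ 1) (h₁ : ∀ i, a₁ i ≠ 0 → dist (π i) c₁ ≤ s)
    (h₂ : ∀ j, a₂ j ≠ 0 → dist (π j) c₂ ≤ s) (hlip : ∀ i j, |a₂ i - a₂ j| ≤ ℓ * dist (π i) (π j))
    (hk : ∀ i j, |k i j| ≤ C * Real.exp (-(δ * dist (π i) (π j))))
    (hΛ : ∀ i, ∑ j, Real.exp (-(δ / 8 * dist (π i) (π j))) ≤ Λ) (v : EuclideanSpace ℝ ι) :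
    ‖mulOp a₁ ((mulOp a₂ * kerOp k - kerOp k * mulOp a₂) v)‖
      ≤ ℓ * C * (24 / (Real.exp 1 * δ)) * Λ * Real.exp (-(5 * δ / 6 * max 0 (dist c₁ c₂ - 2 * s)))
        * ‖v‖ := by
  have e : mulOp a₁ ((mulOp a₂ * kerOp k - kerOp k * mulOp a₂) v)
      = (mulOp a₁ * (mulOp a₂ * kerOp k - kerOp k * mulOp a₂)) v := rfl
  rw [e, three_eq_kerOp]
  have B0 : 0 ≤ ℓ * C * (24 / (Real.exp 1 * δ)) * Real.exp (-(5 * δ / 6 * max 0 (dist c₁ c₂ - 2 * s))) := by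
    positivity
  have main := norm_kerOp_le_of_decay π B0 (fun i j => entry_three_le π hδ hC hℓ hb h₁ h₂ hlip hk i j) hΛ v
  calc _ ≤ _ := main
    _ = _ := by ring

/-- **The unpaired form** («In the second case we have the small factor O(M₀⁻¹) only»): for an `ℓ`-Lipschitz
multiplier and `|k_ij| ≤ C e^{−δ dist}`, `‖[mulOp a, kerOp k] v‖ ≤ ℓ·C·(2/(eδ))·Λ′·‖v‖` with `Λ′` the row-sum bound
at rate `δ/2`. [cite: Balaban1984PropagatorsI, p.38 before (1.128)] -/
theorem norm_comm_kernel_le (π : ι → X) {a : ι → ℝ} {ℓ C δ Λ' : ℝ} {k : ι → ι → ℝ}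
    (hδ : 0 < δ) (hC : 0 ≤ C) (hℓ : 0 ≤ ℓ) (hlip : ∀ i j, |a i - a j| ≤ ℓ * dist (π i) (π j))
    (hk : ∀ i j, |k i j| ≤ C * Real.exp (-(δ * dist (π i) (π j))))
    (hΛ : ∀ i, ∑ j, Real.exp (-(δ / 2 * dist (π i) (π j))) ≤ Λ') (v : EuclideanSpace ℝ ι) :
    ‖(mulOp a * kerOp k - kerOp k * mulOp a) v‖ ≤ ℓ * C * (2 / (Real.exp 1 * δ)) * Λ' * ‖v‖ := by
  rw [comm_mulOp_kerOp]
  have B0 : 0 ≤ ℓ * C * (2 / (Real.exp 1 * δ)) := by positivity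
  have hent : ∀ i j, |(a i - a j) * k i j|
      ≤ ℓ * C * (2 / (Real.exp 1 * δ)) * Real.exp (-(δ / 2 * dist (π i) (π j))) := by
    intro i j
    rw [abs_mul]
    have ht0 : 0 ≤ dist (π i) (π j) := dist_nonneg
    calc |a i - a j| * |k i j|
        ≤ (ℓ * dist (π i) (π j)) * (C * Real.exp (-(δ * dist (π i) (π j)))) :=
          mul_le_mul (hlip i j) (hk i j) (abs_nonneg _) (by positivity)
      _ = ℓ * C * (dist (π i) (π j) * Real.exp (-(δ * dist (π i) (π j)))) := by ring
      _ ≤ ℓ * C * (2 / (Real.exp 1 * δ) * Real.exp (-(δ / 2 * dist (π i) (π j)))) :=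
          mul_le_mul_of_nonneg_left (mul_exp_half hδ _) (by positivity)
      _ = _ := by ring
  exact norm_kerOp_le_of_decay π B0 hent hΛ v

end KernelPart

/-! ## §5  The local part: finite-range kernels -/

section LocalPart

variable {ι : Type} [Fintype ι] {X : Type} [PseudoMetricSpace X]

/-- **Locality of the paired commutator with a finite-range kernel**: if `l_ij = 0` beyond distance `ρ` and the
supports of `a₁`, `a₂` (radius `s` around `c₁`, `c₂`) satisfy `dist(c₁,c₂) > 2s + ρ`, then
`mulOp a₁ * [mulOp a₂, kerOp l] = 0` («K(h) is a simple, shortranged, first order differential operator»: outside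
the reach of □_{z₂} the commutator with the local part does not see h_{z₁}). [cite: Balaban1984PropagatorsI, p.38] -/
theorem three_local_eq_zero (π : ι → X) {a₁ a₂ : ι → ℝ} {c₁ c₂ : X} {s ρ : ℝ} {l : ι → ι → ℝ}
    (h₁ : ∀ i, a₁ i ≠ 0 → dist (π i) c₁ ≤ s) (h₂ : ∀ j, a₂ j ≠ 0 → dist (π j) c₂ ≤ s)
    (hl : ∀ i j, ρ < dist (π i) (π j) → l i j = 0) (hT : 2 * s + ρ < dist c₁ c₂) :
    mulOp a₁ * (mulOp a₂ * kerOp l - kerOp l * mulOp a₂) = 0 := by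
  rw [three_eq_kerOp]
  apply kerOp_eq_zero_of_forall
  intro i j
  by_cases h0 : a₁ i * (a₂ i - a₂ j) = 0
  · rw [← mul_assoc, h0, zero_mul]
  have hi : a₁ i ≠ 0 := fun h => h0 (by rw [h, zero_mul])
  have hij : a₂ i - a₂ j ≠ 0 := fun h => h0 (by rw [h, mul_zero])
  have hD := sepPos_of_entry_ne π h₁ h₂ hi hij
  have hfar : ρ < dist (π i) (π j) := by
    have : dist c₁ c₂ - 2 * s ≤ dist (π i) (π j) := le_trans (le_max_right _ _) hD
    linarith
  rw [hl i j hfar, mul_zero, mul_zero]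

end LocalPart

/-! ## §6  Assembly in the shape of `B5Local114.Realisation.h128` -/

section Assembly

variable {ι : Type} [Fintype ι] {X : Type} [PseudoMetricSpace X]

/-- **The hypotheses of the schema** for `Δa = kerOp l + kerOp k`, `H z = mulOp (a z)`: profiles bounded by `1`,
supported in `s`-balls around the centres `c z`, `ℓ`-Lipschitz along `π`; a finite-range part `l` (range `ρ`) whose
commutators with the `H z` obey the NORMED LOCAL HYPOTHESIS `‖[H z, kerOp l] A‖ ≤ ℓ₁(‖Dg A‖ + ‖A‖)` (for Bałaban's
`Δ_a` this is the computation (1.121) and needs `∂h = O(M₀⁻¹)` and `Δh = O(M₀⁻²)` — NOT discharged in this module,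
cell GAPS G-B5-28a); a kernel part `k` with `|k_ij| ≤ C e^{−δ dist(π i, π j)}` (the role of (1.126)) and uniform row
sums `Λ` at rate `δ/8`. An instantiation supplies all of it. [cite: Balaban1984PropagatorsI, (1.121) p.37, (1.126) p.38] -/
structure Schema (π : ι → X) {S : Type} (a : S → ι → ℝ) (c : S → X) (l k : ι → ι → ℝ)
    (Dg : Module.End ℝ (EuclideanSpace ℝ ι)) (s ℓ ℓ₁ ρ C δ Λ : ℝ) : Prop where
  /-- `|a z i| ≤ 1` -/
  abs_le : ∀ z i, |a z i| ≤ 1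
  /-- `a z` is supported in the `s`-ball of `c z` -/
  supp : ∀ z i, a z i ≠ 0 → dist (π i) (c z) ≤ s
  /-- `a z` is `ℓ`-Lipschitz along `π` -/
  lip : ∀ z i j, |a z i - a z j| ≤ ℓ * dist (π i) (π j)
  /-- `0 ≤ ℓ` -/
  lip_nonneg : 0 ≤ ℓ
  /-- `l` has range `ρ` -/
  range : ∀ i j, ρ < dist (π i) (π j) → l i j = 0
  /-- the normed local hypothesis (the (1.121) computation, NOT discharged here) -/
  local_norm : ∀ z A, ‖(mulOp (a z) * kerOp l - kerOp l * mulOp (a z)) A‖ ≤ ℓ₁ * (‖Dg A‖ + ‖A‖)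
  /-- `0 ≤ ℓ₁` -/
  loc_nonneg : 0 ≤ ℓ₁
  /-- `|k_ij| ≤ C e^{−δ dist(π i, π j)}` (the role of (1.126)) -/
  decay : ∀ i j, |k i j| ≤ C * Real.exp (-(δ * dist (π i) (π j)))
  /-- `0 ≤ C` -/
  C_nonneg : 0 ≤ C
  /-- `0 < δ` -/
  δ_pos : 0 < δ
  /-- uniform row sums at rate `δ/8` -/
  rowsum : ∀ i, ∑ j, Real.exp (-(δ / 8 * dist (π i) (π j))) ≤ Λ

/-- **The schema of (1.126) ⟹ (1.128)**: under `Schema`, `0 < M₀` and `s ≤ 2M₀`,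
`‖H z₁ (Kop Δa H z₂ A)‖ ≤ (ℓ₁·e^{4+ρ/M₀} + ℓ·C·(24/(eδ))·Λ·e^7)·e^{−twoDelta0 δ M₀·dist(c z₁, c z₂)}·(‖Dg A‖ + ‖A‖)`
for `Δa = kerOp l + kerOp k`, `H z = mulOp (a z)` — the SHAPE of the field `h128` of `B5Local114.Model` /
`B5Local114.Realisation` («|h_{z₁}K(h_{z₂})A| ≤ O(M₀⁻¹)e^{−2δ₀|z₁−z₂|}(|∇A| + |A|)», 2δ₀ = min{⅓δ′₀, M₀⁻¹}), with the
constant of order `M₀⁻¹` as soon as `ℓ, ℓ₁ = O(M₀⁻¹)`. The local part is carried by the hypothesis `local_norm` and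
the proved locality `three_local_eq_zero`; the kernel part is proved (`norm_three_kernel_le`, `exp_sep_le`).
[cite: Balaban1984PropagatorsI, (1.128) p.38] -/
theorem h128_schema {π : ι → X} {S : Type} {a : S → ι → ℝ} {c : S → X} {l k : ι → ι → ℝ}
    {Dg : Module.End ℝ (EuclideanSpace ℝ ι)} {s ℓ ℓ₁ ρ C δ Λ : ℝ}
    (hS : Schema π a c l k Dg s ℓ ℓ₁ ρ C δ Λ) {M₀ : ℝ} (hM : 0 < M₀) (hs : s ≤ 2 * M₀)
    (z₁ z₂ : S) (A : EuclideanSpace ℝ ι) :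
    ‖mulOp (a z₁) (Kop (kerOp l + kerOp k) (fun z => mulOp (a z)) z₂ A)‖
      ≤ (ℓ₁ * Real.exp (4 + ρ / M₀) + ℓ * C * (24 / (Real.exp 1 * δ)) * Λ * Real.exp 7)
        * Real.exp (-(twoDelta0 δ M₀ * dist (c z₁) (c z₂))) * (‖Dg A‖ + ‖A‖) := by
  have hT0 : 0 ≤ dist (c z₁) (c z₂) := dist_nonneg
  have hE0 : 0 < Real.exp (-(twoDelta0 δ M₀ * dist (c z₁) (c z₂))) := Real.exp_pos _
  have hδ := hS.δ_pos
  have hC := hS.C_nonneg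
  have hℓ := hS.lip_nonneg
  have hℓ₁ := hS.loc_nonneg
  rcases isEmpty_or_nonempty ι with hι | ⟨⟨i₀⟩⟩
  · -- no components: every vector of `ℓ²(∅)` has norm `0`
    have hn : ∀ w : EuclideanSpace ℝ ι, ‖w‖ = 0 := fun w => by rw [EuclideanSpace.norm_eq]; simp
    rw [hn, hn A, hn (Dg A)]
    simp
  have hΛ : 0 ≤ Λ := le_trans (Finset.sum_nonneg fun j _ => (Real.exp_pos _).le) (hS.rowsum i₀)
  rw [Kop_add, LinearMap.add_apply, map_add]
  -- the local term
  have hloc : ‖mulOp (a z₁) (Kop (kerOp l) (fun z => mulOp (a z)) z₂ A)‖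
      ≤ ℓ₁ * Real.exp (4 + ρ / M₀) * Real.exp (-(twoDelta0 δ M₀ * dist (c z₁) (c z₂))) * (‖Dg A‖ + ‖A‖) := by
    rcases lt_or_ge (2 * s + ρ) (dist (c z₁) (c z₂)) with hfar | hnear
    · have h0 : mulOp (a z₁) * (mulOp (a z₂) * kerOp l - kerOp l * mulOp (a z₂)) = 0 :=
        three_local_eq_zero π (hS.supp z₁) (hS.supp z₂) hS.range hfar
      have : mulOp (a z₁) (Kop (kerOp l) (fun z => mulOp (a z)) z₂ A) = 0 := by
        have e : mulOp (a z₁) (Kop (kerOp l) (fun z => mulOp (a z)) z₂ A)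
            = (mulOp (a z₁) * (mulOp (a z₂) * kerOp l - kerOp l * mulOp (a z₂))) A := rfl
        rw [e, h0, LinearMap.zero_apply]
      rw [this, norm_zero]
      positivity
    · have h1 : ‖mulOp (a z₁) (Kop (kerOp l) (fun z => mulOp (a z)) z₂ A)‖
          ≤ 1 * ‖Kop (kerOp l) (fun z => mulOp (a z)) z₂ A‖ := norm_mulOp_le zero_le_one (hS.abs_le z₁) _
      have h2 : ‖Kop (kerOp l) (fun z => mulOp (a z)) z₂ A‖ ≤ ℓ₁ * (‖Dg A‖ + ‖A‖) := hS.local_norm z₂ A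
      have h3 : 1 ≤ Real.exp (4 + ρ / M₀) * Real.exp (-(twoDelta0 δ M₀ * dist (c z₁) (c z₂))) :=
        one_le_exp_local hM hs hT0 hnear
      have hn0 : 0 ≤ ‖Dg A‖ + ‖A‖ := by positivity
      calc ‖mulOp (a z₁) (Kop (kerOp l) (fun z => mulOp (a z)) z₂ A)‖
          ≤ ℓ₁ * (‖Dg A‖ + ‖A‖) := by rw [one_mul] at h1; exact h1.trans h2
        _ = ℓ₁ * (‖Dg A‖ + ‖A‖) * 1 := by ring
        _ ≤ ℓ₁ * (‖Dg A‖ + ‖A‖)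
              * (Real.exp (4 + ρ / M₀) * Real.exp (-(twoDelta0 δ M₀ * dist (c z₁) (c z₂)))) :=
            mul_le_mul_of_nonneg_left h3 (by positivity)
        _ = _ := by ring
  -- the kernel term
  have hker : ‖mulOp (a z₁) (Kop (kerOp k) (fun z => mulOp (a z)) z₂ A)‖
      ≤ ℓ * C * (24 / (Real.exp 1 * δ)) * Λ * Real.exp 7
        * Real.exp (-(twoDelta0 δ M₀ * dist (c z₁) (c z₂))) * (‖Dg A‖ + ‖A‖) := by
    have h1 := norm_three_kernel_le π hδ hC hℓ (hS.abs_le z₁) (hS.supp z₁) (hS.supp z₂) (hS.lip z₂)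
      hS.decay hS.rowsum A
    have h2 := exp_sep_le hδ hM hs hT0
    have hA : ‖A‖ ≤ ‖Dg A‖ + ‖A‖ := le_add_of_nonneg_left (norm_nonneg _)
    have e : mulOp (a z₁) (Kop (kerOp k) (fun z => mulOp (a z)) z₂ A)
        = mulOp (a z₁) ((mulOp (a z₂) * kerOp k - kerOp k * mulOp (a z₂)) A) := rfl
    rw [e]
    calc _ ≤ ℓ * C * (24 / (Real.exp 1 * δ)) * Λ * Real.exp (-(5 * δ / 6 * max 0 (dist (c z₁) (c z₂) - 2 * s)))
          * ‖A‖ := h1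
      _ ≤ ℓ * C * (24 / (Real.exp 1 * δ)) * Λ
          * (Real.exp 7 * Real.exp (-(twoDelta0 δ M₀ * dist (c z₁) (c z₂)))) * (‖Dg A‖ + ‖A‖) := by
          apply mul_le_mul _ hA (norm_nonneg _) (by positivity)
          exact mul_le_mul_of_nonneg_left h2 (by positivity)
      _ = _ := by ring
  calc ‖mulOp (a z₁) (Kop (kerOp l) (fun z => mulOp (a z)) z₂ A)
        + mulOp (a z₁) (Kop (kerOp k) (fun z => mulOp (a z)) z₂ A)‖
      ≤ ‖mulOp (a z₁) (Kop (kerOp l) (fun z => mulOp (a z)) z₂ A)‖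
        + ‖mulOp (a z₁) (Kop (kerOp k) (fun z => mulOp (a z)) z₂ A)‖ := norm_add_le _ _
    _ ≤ _ := add_le_add hloc hker
    _ = _ := by ring

/-- **Specialisation to the partition of unity of `B5TorusPartition`** (`H = Hop N M₀ π`, centres `ctrU N M₀`,
supports of radius `2M₀`, Lipschitz constant `8d/M₀` by `hzU_lipschitz`): for `Δa = kerOp l + kerOp k` on `ℓ²(ι)`
over the unit torus `UT N`, with `l` of range `ρ`, the normed local hypothesis `ℓ₁`, `|k_ij| ≤ C e^{−δ dist}` and row
sums `Λ` at rate `δ/8`,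
`‖Hop z₁ (Kop Δa Hop z₂ A)‖ ≤ (ℓ₁·e^{4+ρ/M₀} + (8d/M₀)·C·(24/(eδ))·Λ·e^7)·e^{−twoDelta0 δ M₀·dist(ctrU z₁, ctrU z₂)}·(‖Dg A‖ + ‖A‖)`
— the field `h128` of `B5Local114.Realisation` in this model, up to the instantiation of `ℓ₁`, `C`, `Λ` (header,
HONEST LABELLING). [cite: Balaban1984PropagatorsI, (1.128) p.38] -/
theorem h128_torus {d : ℕ} {N : Fin d → ℕ} [∀ i, NeZero (N i)] {M₀ : ℕ} (hM : 1 ≤ M₀) (π : ι → UT N)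
    {l k : ι → ι → ℝ} {Dg : Module.End ℝ (EuclideanSpace ℝ ι)} {ℓ₁ ρ C δ Λ : ℝ}
    (range : ∀ i j, ρ < dist (π i) (π j) → l i j = 0)
    (local_norm : ∀ z A, ‖(Hop N M₀ π z * kerOp l - kerOp l * Hop N M₀ π z) A‖ ≤ ℓ₁ * (‖Dg A‖ + ‖A‖))
    (hℓ₁ : 0 ≤ ℓ₁) (decay : ∀ i j, |k i j| ≤ C * Real.exp (-(δ * dist (π i) (π j)))) (hC : 0 ≤ C)
    (hδ : 0 < δ) (rowsum : ∀ i, ∑ j, Real.exp (-(δ / 8 * dist (π i) (π j))) ≤ Λ)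
    (z₁ z₂ : Ctr N M₀) (A : EuclideanSpace ℝ ι) :
    ‖Hop N M₀ π z₁ (Kop (kerOp l + kerOp k) (Hop N M₀ π) z₂ A)‖
      ≤ (ℓ₁ * Real.exp (4 + ρ / M₀) + 8 * d / M₀ * C * (24 / (Real.exp 1 * δ)) * Λ * Real.exp 7)
        * Real.exp (-(twoDelta0 δ M₀ * dist (ctrU N M₀ z₁) (ctrU N M₀ z₂))) * (‖Dg A‖ + ‖A‖) := by
  have hM' : (0 : ℝ) < M₀ := by exact_mod_cast hM
  have hS : Schema π (fun z i => hzU N M₀ z (π i)) (ctrU N M₀) l k Dg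
      (2 * M₀) (8 * d / M₀) ℓ₁ ρ C δ Λ :=
    { abs_le := fun z i => by
        have h := hzU_mem_Icc N hM z (π i)
        rw [abs_of_nonneg h.1]
        exact h.2
      supp := fun z i hne => by
        by_contra hfar
        exact hne (hz_eq_zero_of_le (UT.one_le N) hM (le_of_lt (not_le.mp hfar)))
      lip := fun z i j => hzU_lipschitz N hM z (π i) (π j)
      lip_nonneg := by positivity
      range := range
      local_norm := local_norm
      loc_nonneg := hℓ₁
      decay := decay
      C_nonneg := hC
      δ_pos := hδ
      rowsum := rowsum }
  exact h128_schema hS hM' le_rfl z₁ z₂ A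

end Assembly

/-! ## §7  Row sums on a torus-fibred component set (discharging `Schema.rowsum` in the torus model) -/

section RowSums

variable {ι : Type} [Fintype ι] {d : ℕ} {N : Fin d → ℕ} [∀ i, NeZero (N i)]

/-- **Row sums through a base map with bounded fibres**: if every torus site carries at most `m` components
(`#{j : π j = y} ≤ m`), then `Σ_j e^{−β dist(π i, π j)} ≤ m · K_d(β)` uniformly in the periods, with the tree's lattice
constant `B4Sect5Proof.latticeConst d β` (`B4Sect5Torus.torusSum_le`). [folklore] -/
theorem rowsum_fibre_le (π : ι → UT N) {m : ℕ}
    (hm : ∀ y : UT N, ((Finset.univ.filter fun j : ι => π j = y).card : ℝ) ≤ m) {β : ℝ} (hβ : 0 < β) (i : ι) :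
    ∑ j, Real.exp (-(β * dist (π i) (π j))) ≤ m * B4Sect5Proof.latticeConst d β := by
  classical
  have hfib : ∑ j, Real.exp (-(β * dist (π i) (π j)))
      = ∑ y : UT N, ∑ j ∈ Finset.univ.filter (fun j : ι => π j = y), Real.exp (-(β * dist (π i) (π j))) :=
    (Finset.sum_fiberwise_of_maps_to (s := Finset.univ) (t := Finset.univ) (g := π)
      (f := fun j => Real.exp (-(β * dist (π i) (π j)))) (fun j _ => Finset.mem_univ _)).symm
  rw [hfib]
  have hinner : ∀ y : UT N, ∑ j ∈ Finset.univ.filter (fun j : ι => π j = y), Real.exp (-(β * dist (π i) (π j)))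
      ≤ m * Real.exp (-(β * dist (π i) y)) := by
    intro y
    have heq : ∑ j ∈ Finset.univ.filter (fun j : ι => π j = y), Real.exp (-(β * dist (π i) (π j)))
        = ∑ j ∈ Finset.univ.filter (fun j : ι => π j = y), Real.exp (-(β * dist (π i) y)) :=
      Finset.sum_congr rfl fun j hj => by rw [(Finset.mem_filter.mp hj).2]
    rw [heq, Finset.sum_const, nsmul_eq_mul]
    exact mul_le_mul_of_nonneg_right (hm y) (Real.exp_pos _).le
  calc ∑ y : UT N, ∑ j ∈ Finset.univ.filter (fun j : ι => π j = y), Real.exp (-(β * dist (π i) (π j)))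
      ≤ ∑ y : UT N, m * Real.exp (-(β * dist (π i) y)) := Finset.sum_le_sum fun y _ => hinner y
    _ = m * ∑ y : UT N, Real.exp (-(β * dist (π i) y)) := by rw [Finset.mul_sum]
    _ ≤ m * B4Sect5Proof.latticeConst d β := by
        have ht : ∑ y : UT N, Real.exp (-(β * dist (π i) y)) ≤ B4Sect5Proof.latticeConst d β :=
          torusSum_le d (UT.one_le N) hβ (UT.toSite N (π i))
        exact mul_le_mul_of_nonneg_left ht (Nat.cast_nonneg m)

/-- **`h128` in the torus model with the row sums discharged**: as `h128_torus`, for a base map with fibres of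
size `≤ m`, with `Λ := m · K_d(δ/8)`; the remaining hypotheses are the split `Δa = kerOp l + kerOp k` with `l` of
range `ρ` and its normed local bound `ℓ₁` (the (1.121) computation, cell GAPS G-B5-29 (c)), and the decay of `k`
((1.126), GAPS G-B5-29 (b)). [cite: Balaban1984PropagatorsI, (1.128) p.38] -/
theorem h128_torus_fibre {M₀ : ℕ} (hM : 1 ≤ M₀) (π : ι → UT N) {m : ℕ}
    (hm : ∀ y : UT N, ((Finset.univ.filter fun j : ι => π j = y).card : ℝ) ≤ m)
    {l k : ι → ι → ℝ} {Dg : Module.End ℝ (EuclideanSpace ℝ ι)} {ℓ₁ ρ C δ : ℝ}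
    (range : ∀ i j, ρ < dist (π i) (π j) → l i j = 0)
    (local_norm : ∀ z A, ‖(Hop N M₀ π z * kerOp l - kerOp l * Hop N M₀ π z) A‖ ≤ ℓ₁ * (‖Dg A‖ + ‖A‖))
    (hℓ₁ : 0 ≤ ℓ₁) (decay : ∀ i j, |k i j| ≤ C * Real.exp (-(δ * dist (π i) (π j)))) (hC : 0 ≤ C)
    (hδ : 0 < δ) (z₁ z₂ : Ctr N M₀) (A : EuclideanSpace ℝ ι) :
    ‖Hop N M₀ π z₁ (Kop (kerOp l + kerOp k) (Hop N M₀ π) z₂ A)‖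
      ≤ (ℓ₁ * Real.exp (4 + ρ / M₀)
          + 8 * d / M₀ * C * (24 / (Real.exp 1 * δ)) * (m * B4Sect5Proof.latticeConst d (δ / 8)) * Real.exp 7)
        * Real.exp (-(twoDelta0 δ M₀ * dist (ctrU N M₀ z₁) (ctrU N M₀ z₂))) * (‖Dg A‖ + ‖A‖) :=
  h128_torus hM π range local_norm hℓ₁ decay hC hδ
    (fun i => rowsum_fibre_le π hm (by positivity) i) z₁ z₂ A

end RowSums




end

end Literature.MathematicalPhysics.QuantumFieldTheory.Balaban1983to89.B5Commutator128
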